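import Literature.NumberTheory.EllipticCurves.TamagawaFiniteIndexProofs
import Literature.NumberTheory.EllipticCurves.LocalPointsIntegersSubgroup
import Literature.NumberTheory.EllipticCurves.VariableChangePointsMap
import Literature.NumberTheory.EllipticCurves.InertiaInvariantsKodairaNeronAdditiveProofs
import Mathlib.GroupTheory.Perm.Cycle.Type
import HarnessLib

/-!
# A Tamagawa factor divisible by `p` forces a nonzero `p`-torsion point of `E(K_v)` (`v ∤ p`):
# the hypothesis `hne` of `Additive/UnramifiedKummerDisjoint.lean`
# (cell `b2b-bsdres`, team n1011, seat p06 GEN 4; OWNERS row T-E3g-ADD, FILE C)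

HONEST FRAMING (cell `b2b-bsdres`, run/shared/lean/b2b/bsd-rank1-residual/, verbatim in every
file): the goal of the cell is to DELETE the COMBINATION-SHAPED residual classes of the
Birch–Swinnerton-Dyer formula for ALL analytic-rank `≤ 1` elliptic curves over `ℚ` — "full BSD
formula for every rank `≤ 1` curve in class `C`" assembled STRICTLY from published theorems — so
that the rank-`≤ 1` remainder becomes exactly the CONSTRUCTION-SHAPED classes, which are TYPED
(missing-input `Prop`s), NOT attempted. This is not "finishing BSD". Team n1011 (N10/N11: X4 ∧
`p = 3`): research routes on CONSTRUCTION-SHAPED classes; census output = EVIDENCE / conjecture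
items, never a Literature fact; RESIDUAL-MAP marks UNCHANGED; nothing is booked by this file.
THEOREMS ONLY: no definition, no named fact, nothing asserted.

## What (row T-E3g-ADD; FILE A = `Additive/UnramifiedKummerDisjoint.lean`)

FILE A's witness `∃ u ∈ H¹_ur(K_v, E[p]), u ∉ 𝓚_v` at a finite `v ∤ p` takes, besides the
inertia-torsion hypothesis `hI` (FILE B, additive places), ONE nonzero point `T ∈ E(K_v)` with
`p • T = 0`. THIS FILE produces it from the Tamagawa factor: **at any finite `v ∤ p` (no
reduction-type hypothesis), `p ∣ c_v = [E(K_v) : E₀(K_v)] ⟹ E(K_v)[p] ≠ 0`.**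

Proof (elementary; Greenberg LNM 1716 p. 74 "`|ker r_v| = c_v^{(p)}`" is its `p^∞`-form):
(§1) in an abelian group `G` with a subgroup `H` of finite index divisible by `p`, multiplication
by `p` is NOT onto (`G/H` has an element of order `p` by Cauchy; if `p • G = G` then `p •` would be
onto, hence injective, on the finite group `G/H`); (§2) `c_v ≠ 0`
(`localTamagawaNumber_baseChange_ne_zero`) is the index of `E₀ ≤ X(K_v)` on the minimal model
`X = C • E_{K_v}` (`localTamagawaNumber_baseChange_eq`), transported to `E(K_v)` by the change of
variables (`VariableChange.pointEquiv`, `Affine.Point.congrEquiv`), so `E(K_v)/p ≠ 0`; and by the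
structure of `E(K_v)` (Silverman VII.6.3 / Milne I.3.3, tree
`card_quotient_range_nsmul_adicCompletion`: `#E(K_v)/p = #E(K_v)[p] · #𝓞_v/p`, with `#𝓞_v/p = 1`
at `v ∤ p`) the `p`-torsion `E(K_v)[p]` has the same order as `E(K_v)/p`, hence is nonzero.

References: J. H. Silverman, *AEC* 2nd ed. (2009) Prop. VII.6.3, Cor. VII.6.2 [SilvermanAEC2009];
J. S. Milne, *Arithmetic Duality Theorems* (2006) I Lemma 3.3 [MilneADT2006]; R. Greenberg,
LNM 1716 (1999) p. 74 [GreenbergLNM1716].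
-/

set_option autoImplicit false

noncomputable section

open scoped Classical NNReal

open NumberField IsDedekindDomain Field
open Literature.NumberTheory.EllipticCurves

namespace Summit.BirchSwinnertonDyer.Rank1Residual.Additive

universe u

/-! ### §1 Group theory: an index divisible by `p` obstructs `p`-divisibility -/

/-- In an abelian group `G`, if a subgroup `H` has finite index divisible by the prime `p`, then
multiplication by `p` is not surjective on `G` (Cauchy's theorem in `G ⧸ H`). [folklore] -/
theorem range_nsmul_ne_top_of_dvd_index {G : Type*} [AddCommGroup G] (H : AddSubgroup G)
    {p : ℕ} [hp : Fact p.Prime] (hH : H.index ≠ 0) (hdvd : p ∣ H.index) :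
    (nsmulAddMonoidHom p : G →+ G).range ≠ ⊤ := by
  intro htop
  haveI : H.FiniteIndex := ⟨hH⟩
  haveI : Finite (G ⧸ H) := AddSubgroup.finite_quotient_of_finiteIndex
  obtain ⟨q, hq⟩ := exists_prime_addOrderOf_dvd_card' (G := G ⧸ H) p (by rwa [← AddSubgroup.index])
  -- multiplication by `p` is onto `G`, hence onto and then injective on the finite `G ⧸ H`
  have hsurj : Function.Surjective fun x : G ⧸ H ↦ p • x := by
    intro x
    obtain ⟨g, rfl⟩ := QuotientAddGroup.mk_surjective x
    have hg : g ∈ (nsmulAddMonoidHom p : G →+ G).range := htop ▸ AddSubgroup.mem_top g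
    obtain ⟨g', hg'⟩ := hg
    refine ⟨QuotientAddGroup.mk g', ?_⟩
    show p • (QuotientAddGroup.mk g' : G ⧸ H) = QuotientAddGroup.mk g
    rw [← QuotientAddGroup.mk_nsmul]
    exact congrArg QuotientAddGroup.mk hg'
  have hinj : Function.Injective fun x : G ⧸ H ↦ p • x :=
    Finite.injective_iff_surjective.mpr hsurj
  have hq0 : p • q = 0 := by rw [← hq]; exact addOrderOf_nsmul_eq_zero q
  have hq' : q = 0 := hinj (by simp only [hq0, smul_zero])
  rw [hq', addOrderOf_zero] at hq
  exact hp.out.one_lt.ne' hq.symm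

/-- If multiplication by `p` is not surjective on `G` and `#(G ⧸ pG) = #G[p] · 1`-type bookkeeping
holds in the form `#(G ⧸ pG) = #G[p]` with both finite, then `G[p] ≠ 0`: there is `T ≠ 0` with
`p • T = 0`. [folklore] -/
theorem exists_ne_zero_nsmul_eq_zero_of_range_ne_top {G : Type*} [AddCommGroup G] {p : ℕ}
    [Finite (G ⧸ (nsmulAddMonoidHom p : G →+ G).range)]
    (hcard : Nat.card (G ⧸ (nsmulAddMonoidHom p : G →+ G).range) =
      Nat.card (nsmulAddMonoidHom p : G →+ G).ker)
    (hne : (nsmulAddMonoidHom p : G →+ G).range ≠ ⊤) :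
    ∃ T : G, T ≠ 0 ∧ p • T = 0 := by
  have h2 : 1 < Nat.card (G ⧸ (nsmulAddMonoidHom p : G →+ G).range) := by
    rw [Finite.one_lt_card_iff_nontrivial]
    by_contra hnt
    rw [not_nontrivial_iff_subsingleton] at hnt
    exact hne (QuotientAddGroup.subsingleton_iff.mp hnt)
  rw [hcard] at h2
  haveI : Finite (nsmulAddMonoidHom p : G →+ G).ker := Nat.finite_of_card_ne_zero (by omega)
  haveI : Nontrivial (nsmulAddMonoidHom p : G →+ G).ker := Finite.one_lt_card_iff_nontrivial.mp h2
  obtain ⟨T, hT⟩ := exists_ne (0 : (nsmulAddMonoidHom p : G →+ G).ker)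
  exact ⟨T, fun h ↦ hT (Subtype.ext h), T.2⟩

/-! ### §2 `p ∣ c_v`, `v ∤ p ⟹ E(K_v)[p] ≠ 0` -/

section Curve

variable {K : Type u} [Field K] [NumberField K] (W : WeierstrassCurve K) [W.IsElliptic] (p : ℕ)
  [hp : Fact p.Prime] (v : HeightOneSpectrum (𝓞 K))

omit hp in
/-- `#(𝓞_v ⧸ p) = 1` at `v ∤ p` (`p` is a unit of `𝓞_v`). [folklore] -/
theorem natCard_quotient_span_natCast_eq_one (hpv : ((p : ℕ) : 𝓞 K) ∉ v.asIdeal) :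
    Nat.card (v.adicCompletionIntegers K ⧸
      Ideal.span {((p : ℕ) : v.adicCompletionIntegers K)}) = 1 := by
  have hu : IsUnit ((p : ℕ) : v.adicCompletionIntegers K) := by
    rw [LocalPoints.isUnit_iff_valuation_eq_one]
    exact LocalPoints.valuation_natCast_eq_one v hpv
  rw [Ideal.span_singleton_eq_top.mpr hu]
  haveI : Subsingleton (v.adicCompletionIntegers K ⧸ (⊤ : Ideal (v.adicCompletionIntegers K))) :=
    Ideal.Quotient.subsingleton_iff.mpr rfl
  exact Nat.card_of_subsingleton (0 : v.adicCompletionIntegers K ⧸ (⊤ : Ideal _))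

/-- **`p ∣ c_v` and `v ∤ p ⟹ E(K_v)[p] ≠ 0`**: for an elliptic curve `E` over a number field `K`,
a prime `p` and a finite place `v ∤ p` whose Tamagawa factor `c_v = [E(K_v) : E₀(K_v)]`
(`localTamagawaNumber` of `E ⊗ K_v`) is divisible by `p`, there is a nonzero `T ∈ E(K_v)` with
`p • T = 0`. (§1 with `H = E₀` on the minimal model, transported to `E(K_v)` by the change of
variables; then `#E(K_v)[p] = #E(K_v)/p` at `v ∤ p`, Silverman VII.6.3 / Milne I.3.3.) No
hypothesis on the reduction type. [cite: SilvermanAEC2009, Prop. VII.6.3 and Cor. VII.6.2]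
[cite: MilneADT2006, I Lemma 3.3] [cite: GreenbergLNM1716, §2, p. 74] -/
theorem exists_point_ne_zero_nsmul_eq_zero_of_dvd_localTamagawaNumber
    (hpv : ((p : ℕ) : 𝓞 K) ∉ v.asIdeal)
    (hc : p ∣ (W.baseChange (v.adicCompletion K)).localTamagawaNumber (v.adicCompletionIntegers K)) :
    ∃ T : (W.baseChange (v.adicCompletion K)).toAffine.Point, T ≠ 0 ∧ p • T = 0 := by
  have hc0 := W.localTamagawaNumber_baseChange_ne_zero v
  rw [WeierstrassCurve.localTamagawaNumber_baseChange_eq] at hc hc0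
  -- transport `E₀ ≤ X(K_v)` to `E(K_v)` along the change of variables to the minimal model
  obtain ⟨C, hC⟩ := W.exists_variableChange_smul_eq_localMinimalModel v
  set e : (W.baseChange (v.adicCompletion K)).toAffine.Point ≃+
      (W.localMinimalModel v).toAffine.Point :=
    (WeierstrassCurve.VariableChange.pointEquiv (W.baseChange (v.adicCompletion K)) C).trans
      (WeierstrassCurve.Affine.Point.congrEquiv hC) with he
  set H : AddSubgroup (W.baseChange (v.adicCompletion K)).toAffine.Point :=
    ((W.localMinimalModel v).goodReductionSubgroup (v.adicCompletionIntegers K)).comap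
      e.toAddMonoidHom with hH
  have hidx : H.index =
      ((W.localMinimalModel v).goodReductionSubgroup (v.adicCompletionIntegers K)).index :=
    AddSubgroup.index_comap_of_surjective _ e.surjective
  have hrange := range_nsmul_ne_top_of_dvd_index H (p := p) (by rwa [hidx]) (by rwa [hidx])
  -- `#E(K_v)/p = #E(K_v)[p]` at `v ∤ p`
  haveI := W.finite_quotient_range_nsmul_adicCompletion v hp.out.ne_zero
  have hcard := W.card_quotient_range_nsmul_adicCompletion v hp.out.ne_zero (n := p)
  rw [natCard_quotient_span_natCast_eq_one p v hpv, mul_one] at hcard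
  exact exists_ne_zero_nsmul_eq_zero_of_range_ne_top hcard hrange

/-- The same with the torsion condition as an integer multiple, `(p : ℤ) • T = 0` (the currency of
`Additive/UnramifiedKummerDisjoint.lean`). [cite: SilvermanAEC2009, Prop. VII.6.3 and Cor. VII.6.2] -/
theorem exists_point_ne_zero_zsmul_eq_zero_of_dvd_localTamagawaNumber
    (hpv : ((p : ℕ) : 𝓞 K) ∉ v.asIdeal)
    (hc : p ∣ (W.baseChange (v.adicCompletion K)).localTamagawaNumber (v.adicCompletionIntegers K)) :
    ∃ T : (W.baseChange (v.adicCompletion K)).toAffine.Point, T ≠ 0 ∧ (p : ℤ) • T = 0 := by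
  obtain ⟨T, hT, hpT⟩ :=
    exists_point_ne_zero_nsmul_eq_zero_of_dvd_localTamagawaNumber W p v hpv hc
  exact ⟨T, hT, by rw [natCast_zsmul]; exact hpT⟩

end Curve

end Summit.BirchSwinnertonDyer.Rank1Residual.Additive

end
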